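import Literature.AlgebraicGeometry.Frobenioids.KummerClass

/-!
# Kernel DAG index — layer L1, part f (MACHINE DELTA-DRAFT by abc-iut-dag `tools/mkkernel.py` @2026-08-25T22:20Z: 1 landed nodes NOT YET in the tree index Summits/ABC/IUTFork/DAG*.lean filed by abc-iut-c312-2; spec v1.3)

THIS FILE PROVES NOTHING NEW AND ASSERTS NOTHING (plan/KERNEL-DAG-SPEC.md). It gives ONE NAME `N_<kernel_id>` to each DAG node whose
statement has LANDED through the gate, knitting the landed declarations BY NAME. Witness naming (c312-2 F1/F2, 18:39:37Z): `N_<id>_holds`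
exists iff the DAG row is `discharged(p)` (it IS the kernel-checked theorems); a landed row not yet marked discharged by its lead gets the same
conjunction witnessed as `N_<id>_part`; FACT-style `def … : Prop` claims get a name and no witness; CLAIM-FORM items ([IUTchIII] Cor 3.12,
[IUTchIV] Thm 1.10) are `abbrev N_<id> (X) : Prop := X.<Claim>` and the theorems that assume them are EDGES `E_<dst>_of_<src>` (no `__`). Nothing here says abc is proved or refuted or takes a side on [IUTchIII] Cor 3.12. typed ≠ discharged; indexed ≠ endorsed.
Filer of the tree copy: abc-iut-c312-2 (`Summits/ABC/IUTFork/DAGL1f.lean`); this draft is regenerated hourly and is not the tree.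
FILED COPY (filed by abc-iut-c312-8 for the index owner abc-iut-c312-2, WAVE2-SLICES row 78; post-processed by c312-2's fixdraft.py): claim nodes are claim-form abbrevs without `_holds`;
`_holds` only for DAG rows marked discharged, `_part` otherwise (spec §2(b),(c)); edges by name (§3).
-/

namespace Summit.ABC.IUTFork.DAG

namespace PartL1f
/-- `StatementOf h` is the statement (a `Prop`) of which the landed `h` is the proof: the index NAMES statements, it never re-types them. -/
abbrev StatementOf {P : Prop} (_h : P) : Prop := P
end PartL1f
open PartL1f

noncomputable section
universe u₁ u₂ u₃ u₄ u₅ u₆ u₇ u₈ u₉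

/-- [node FrdII:Def2.1(i) · L1/D1 · [FrdII] Def 2.1 (i), kurims p.16 · p404120 · claim · DAG status discharged(p404120)] decls 8 · cites→ FrdII:Ex1.1,FrdII:Ex1.3 -/
def N_FrdII_Def2_1_i : Prop :=
  StatementOf @Literature.AlgebraicGeometry.Frobenioids.Kummer.coe_unitsAct ∧
  StatementOf @Literature.AlgebraicGeometry.Frobenioids.Kummer.unitsAct_one ∧
  StatementOf @Literature.AlgebraicGeometry.Frobenioids.Kummer.unitsAct_mul ∧
  StatementOf @Literature.AlgebraicGeometry.Frobenioids.Kummer.unitsAct_mem_rootsOfUnity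
/-- discharge of `N_FrdII_Def2_1_i`: the landed theorems it names, BY NAME (spec §2(c)); proves nothing new. -/
theorem N_FrdII_Def2_1_i_holds : N_FrdII_Def2_1_i := ⟨@Literature.AlgebraicGeometry.Frobenioids.Kummer.coe_unitsAct, @Literature.AlgebraicGeometry.Frobenioids.Kummer.unitsAct_one, @Literature.AlgebraicGeometry.Frobenioids.Kummer.unitsAct_mul, @Literature.AlgebraicGeometry.Frobenioids.Kummer.unitsAct_mem_rootsOfUnity⟩
example := @Literature.AlgebraicGeometry.Frobenioids.Kummer.unitsAct
example := @Literature.AlgebraicGeometry.Frobenioids.Kummer.cyclotomicPortion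
example := @Literature.AlgebraicGeometry.Frobenioids.Kummer.Mu
example := @Literature.AlgebraicGeometry.Frobenioids.Kummer.IsMuSaturated

end

end Summit.ABC.IUTFork.DAG
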